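import Mathlib
import HarnessLib

/-!
# KL programme — K3 ENGINE child (`KLRegimeEngineV17F2`, stmt-HubbardSuperconductivity-20437), stub (b) weighted lines, cure (c-D)/(F1): the five THRESHOLD
# CONDITIONS of the (c-D) chain ALREADY HOLD at the SHALLOW depth `m₀(j) = 2j + 5 + ⌈log₄|U|⁻¹⌉` (half of `klCDBase`'s logarithm) — STILL one `U₀`-type
# smallness condition each, the SAME conditions as at the deep base

Cell `gate-hubbard-kl`, seat p3 (g11); located note «CD-BASE-LIN» (KL STATUS 2026-08-27 23:31Z) for the pen's base preference (R68d) «the (F1) telescope starts at the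
R-free edge of the derivative route, no U-power spent».  Twins of hubbard-kl-k3c3-p2's `cd_threshold_X1/X2/X3/Y1/Y2` (`…EngineCDThresholdsLow`,
`…EngineCDThresholdsX3`) and `cd_depth_lower`, with the depth hypothesis weakened from `1024e₀² ≤ x·(u²·Λ²)` to **`1024e₀² ≤ x·(u·Λ²)`**.  Bookkeeping: multiply the
threshold through by `W = u^i·Λ^{2+2i}` (`i` = the power of `x`); then `k₁G x^i·W = κ₁g·u²·(x·uΛ²)^i ≥ 1024^iκ₁g e₀^{2i}·u²`, while every monomial `c·u^p/Λ^q` of the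
left side gives `c·u^{p+i}·Λ^{2+2i−q} ≤ c·e₀^{2+2i−q}·u³` because `p + i ≥ 3` — true for all 45 monomials once the mean-free flow piece is read at its TRUE
size `G₀ = c″·|U|·uPow 0 U = g₀·u²` in `Y1` (the one monomial `G₀k₂b₂′` with `p + i = 2` in the `G₀ = g₀u` convention); `X1/X2/X3/Y2` keep k3c3-p2's conventions
verbatim.  So the `u`-free polynomials `S` and the smallness hypotheses `N·u·S ≤ 1024^iκ₁g e₀^{2i}` are IDENTICAL to the deep-base ones: the deep base spent
`u^p ≤ u` where `u^p ≤ u²` was available, which is exactly the slack the shallower base consumes.  (At a FIXED offset, `x ≥ C/Λ²`, the monomial `3G₂k₁α₁` of `X1` would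
force an `R`-dependent `C ≥ 9Gfr₂a₁/Gfr₃`: `log₄|U|⁻¹` is the least depth with `U₀`-type thresholds.)

* **`cd_threshold_X1_lin`**, **`cd_threshold_X2_lin`**, **`cd_threshold_X3_lin`**, **`cd_threshold_Y2_lin`** — k3c3-p2's statements with `hx` weakened, `hU` unchanged;
* **`cd_threshold_Y1_lin`** — `hx` weakened, `hG₀ : G₀ = g₀·u²`, `hU` unchanged;
* **`cd_depth_lower_lin`** — `m ≥ 2j + 5 + ⌈log₄ |U|⁻¹⌉₊ ⇒ 1024·e₀² ≤ 4^m·(|U|·Λ_j²)`, `Λ_j = e₀·4^{−j}`;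
* `pow_ceil_logb_mul_le` (`4^{⌈log₄u⁻¹⌉₊}·u ≤ 4`), **`pow_mul_le_of_le_add_ceil_logb`** (`m ≤ c + ⌈log₄|U|⁻¹⌉₊ ⇒ 4^m·|U| ≤ 4^{c+1}`: the base depth of
  record meets the window hypothesis of p3's deep-window doors with an absolute `d`);
* `pow_window_of_cd_depth_lin` — the same depth in the window currency of p3's `…AlphaWtFlowDeep` / `…OverlapWtFlowDeep` (`4^m·|U| ≥ 1024·16^j`), so the
  derivative-route base (`4^{m+2}·U ≤ 4^{2nf+d}`) and the telescope start tile with an `O(1)` offset.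

Pure real algebra; no definitions, no sorry.  Nothing asserts superconductivity; the consuming (c-D)/(F1) SUM forms (k3c3-p2's `…OscCD` and successors) are not touched here.
-/

noncomputable section

namespace Summit.HubbardSuperconductivity.HubbardSuperconductivity.Theorems.EngineV8

set_option linter.dupNamespace false -- summit = problem name (single-conjunct summit), D-0017

open Real

/-- **Threshold `X1` at the SHALLOW (c-D) depth** (twin of `cd_threshold_X1`): `3·X1 ≤ k₁G₃·x`
for every depth `x` with `1024e₀² ≤ x·u·Λ²` (ONE power of `u`) under the SAME `u`-smallness condition as at the deep base (multiplier `u^1Λ^4`). -/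
theorem cd_threshold_X1_lin {{κ₁ κ₂ g₁ g₂ g₃ a₁ b₁ b₂' e₀ Λ u x k₁ k₂ G₁ G₂ G₃ α₁ : ℝ}}
    (hκ₁ : 0 ≤ κ₁) (hκ₂ : 0 ≤ κ₂) (hg₁ : 0 ≤ g₁) (hg₂ : 0 ≤ g₂) (hg₃ : 0 ≤ g₃) (ha₁ : 0 ≤ a₁) (hb₁ : 0 ≤ b₁) (hb₂' : 0 ≤ b₂')
    (hΛ : 0 < Λ) (hΛe : Λ ≤ e₀) (hu0 : 0 < u) (hu1 : u ≤ 1) (hx : 1024 * e₀ ^ 2 ≤ x * (u * Λ ^ 2))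
    (hk₁ : k₁ = κ₁ / Λ ^ 2) (hk₂ : k₂ = κ₂ / Λ ^ 3) (hG₁ : G₁ = g₁ * u ^ 2) (hG₂ : G₂ = g₂ * u ^ 2) (hG₃ : G₃ = g₃ * u ^ 2) (hα₁ : α₁ = a₁ / Λ)
    (hU : 3 * (u * (3 * b₂' * g₁ * κ₂ * e₀ + 3 * a₁ * g₂ * κ₁ * e₀ + 3 * b₁ * g₂ * κ₂ * e₀)) ≤
      1024 * κ₁ * g₃ * e₀ ^ 2) :
    3 * (3 * G₁ * k₂ * b₂' + 3 * G₂ * k₁ * α₁ + 3 * G₂ * k₂ * b₁) ≤ k₁ * G₃ * x := by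
  subst hk₁ hk₂ hG₁ hG₂ hG₃ hα₁
  have he : 0 < e₀ := lt_of_lt_of_le hΛ hΛe
  have t0 : (3 * b₂' * g₁ * κ₂) * u ^ 3 * Λ ^ 1 ≤ (3 * b₂' * g₁ * κ₂ * e₀) * u ^ 3 :=
    le_of_le_of_eq (mul_le_mul (mul_le_mul_of_nonneg_left (pow_le_pow_of_le_one hu0.le hu1 (show (3 : ℕ) ≤ 3 by norm_num)) (by positivity))
      (pow_le_pow_left₀ hΛ.le hΛe 1) (by positivity) (by positivity)) (by ring)
  have t1 : (3 * a₁ * g₂ * κ₁) * u ^ 3 * Λ ^ 1 ≤ (3 * a₁ * g₂ * κ₁ * e₀) * u ^ 3 :=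
    le_of_le_of_eq (mul_le_mul (mul_le_mul_of_nonneg_left (pow_le_pow_of_le_one hu0.le hu1 (show (3 : ℕ) ≤ 3 by norm_num)) (by positivity))
      (pow_le_pow_left₀ hΛ.le hΛe 1) (by positivity) (by positivity)) (by ring)
  have t2 : (3 * b₁ * g₂ * κ₂) * u ^ 3 * Λ ^ 1 ≤ (3 * b₁ * g₂ * κ₂ * e₀) * u ^ 3 :=
    le_of_le_of_eq (mul_le_mul (mul_le_mul_of_nonneg_left (pow_le_pow_of_le_one hu0.le hu1 (show (3 : ℕ) ≤ 3 by norm_num)) (by positivity))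
      (pow_le_pow_left₀ hΛ.le hΛe 1) (by positivity) (by positivity)) (by ring)
  have hS : (3 * (g₁ * u ^ 2) * (κ₂ / Λ ^ 3) * b₂' + 3 * (g₂ * u ^ 2) * (κ₁ / Λ ^ 2) * (a₁ / Λ) + 3 * (g₂ * u ^ 2) * (κ₂ / Λ ^ 3) * b₁) * (u * Λ ^ 4) ≤
      (3 * b₂' * g₁ * κ₂ * e₀ + 3 * a₁ * g₂ * κ₁ * e₀ + 3 * b₁ * g₂ * κ₂ * e₀) * u ^ 3 := by
    have e : (3 * (g₁ * u ^ 2) * (κ₂ / Λ ^ 3) * b₂' + 3 * (g₂ * u ^ 2) * (κ₁ / Λ ^ 2) * (a₁ / Λ) + 3 * (g₂ * u ^ 2) * (κ₂ / Λ ^ 3) * b₁) * (u * Λ ^ 4) =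
        (3 * b₂' * g₁ * κ₂) * u ^ 3 * Λ ^ 1 + (3 * a₁ * g₂ * κ₁) * u ^ 3 * Λ ^ 1 + (3 * b₁ * g₂ * κ₂) * u ^ 3 * Λ ^ 1 := by
      field_simp
    rw [e]
    linarith only [t0, t1, t2]
  have hT : 1024 * κ₁ * g₃ * e₀ ^ 2 * u ^ 2 ≤ (κ₁ / Λ ^ 2) * (g₃ * u ^ 2) * x * (u * Λ ^ 4) := by
    have hxi : (1024 * e₀ ^ 2) ^ 1 ≤ (x * (u * Λ ^ 2)) ^ 1 := pow_le_pow_left₀ (by positivity) hx 1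
    calc 1024 * κ₁ * g₃ * e₀ ^ 2 * u ^ 2 = κ₁ * g₃ * u ^ 2 * (1024 * e₀ ^ 2) ^ 1 := by ring
      _ ≤ κ₁ * g₃ * u ^ 2 * (x * (u * Λ ^ 2)) ^ 1 := mul_le_mul_of_nonneg_left hxi (by positivity)
      _ = (κ₁ / Λ ^ 2) * (g₃ * u ^ 2) * x * (u * Λ ^ 4) := by field_simp
  have hw : 0 < (u * Λ ^ 4) := by positivity
  refine le_of_mul_le_mul_right ?_ hw
  calc 3 * (3 * (g₁ * u ^ 2) * (κ₂ / Λ ^ 3) * b₂' + 3 * (g₂ * u ^ 2) * (κ₁ / Λ ^ 2) * (a₁ / Λ) + 3 * (g₂ * u ^ 2) * (κ₂ / Λ ^ 3) * b₁) * (u * Λ ^ 4) = 3 * ((3 * (g₁ * u ^ 2) * (κ₂ / Λ ^ 3) * b₂' + 3 * (g₂ * u ^ 2) * (κ₁ / Λ ^ 2) * (a₁ / Λ) + 3 * (g₂ * u ^ 2) * (κ₂ / Λ ^ 3) * b₁) * (u * Λ ^ 4)) := by ring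
    _ ≤ 3 * ((3 * b₂' * g₁ * κ₂ * e₀ + 3 * a₁ * g₂ * κ₁ * e₀ + 3 * b₁ * g₂ * κ₂ * e₀) * u ^ 3) := mul_le_mul_of_nonneg_left hS (by norm_num)
    _ = u ^ 2 * (3 * (u * (3 * b₂' * g₁ * κ₂ * e₀ + 3 * a₁ * g₂ * κ₁ * e₀ + 3 * b₁ * g₂ * κ₂ * e₀))) := by ring
    _ ≤ u ^ 2 * (1024 * κ₁ * g₃ * e₀ ^ 2) := mul_le_mul_of_nonneg_left hU (by positivity)
    _ = 1024 * κ₁ * g₃ * e₀ ^ 2 * u ^ 2 := by ring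
    _ ≤ (κ₁ / Λ ^ 2) * (g₃ * u ^ 2) * x * (u * Λ ^ 4) := hT

/-- **Threshold `X2` at the SHALLOW (c-D) depth** (twin of `cd_threshold_X2`): `3·X2 ≤ k₁G₃·x^2`
for every depth `x` with `1024e₀² ≤ x·u·Λ²` (ONE power of `u`) under the SAME `u`-smallness condition as at the deep base (multiplier `u^2Λ^6`). -/
theorem cd_threshold_X2_lin {{κ₁ κ₂ κ₃ g₀ g₁ g₂ g₃ a₁ a₂ b₁ b₂ b₂' b₃' e₀ Λ u x k₁ k₂ k₃ G₀ G₁ G₂ G₃ α₁ α₂ : ℝ}}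
    (hκ₁ : 0 ≤ κ₁) (hκ₂ : 0 ≤ κ₂) (hκ₃ : 0 ≤ κ₃) (hg₀ : 0 ≤ g₀) (hg₁ : 0 ≤ g₁) (hg₂ : 0 ≤ g₂) (hg₃ : 0 ≤ g₃) (ha₁ : 0 ≤ a₁) (ha₂ : 0 ≤ a₂) (hb₁ : 0 ≤ b₁) (hb₂ : 0 ≤ b₂) (hb₂' : 0 ≤ b₂') (hb₃' : 0 ≤ b₃')
    (hΛ : 0 < Λ) (hΛe : Λ ≤ e₀) (hu0 : 0 < u) (hu1 : u ≤ 1) (hx : 1024 * e₀ ^ 2 ≤ x * (u * Λ ^ 2))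
    (hk₁ : k₁ = κ₁ / Λ ^ 2) (hk₂ : k₂ = κ₂ / Λ ^ 3) (hk₃ : k₃ = κ₃ / Λ ^ 4) (hG₀ : G₀ = g₀ * u) (hG₁ : G₁ = g₁ * u ^ 2) (hG₂ : G₂ = g₂ * u ^ 2) (hG₃ : G₃ = g₃ * u ^ 2) (hα₁ : α₁ = a₁ / Λ) (hα₂ : α₂ = a₂ / Λ ^ 2)
    (hU : 3 * (u * (3 * a₁ * b₂' * g₀ * κ₂ * e₀ ^ 2 + 3 * b₁ * b₂' * g₀ * κ₃ * e₀ ^ 2 + 6 * a₁ * b₁ * g₁ * κ₂ * e₀ ^ 2 + 3 * b₁ ^ 2 * g₁ * κ₃ * e₀ ^ 2 + g₀ * g₃ * κ₂ * e₀ ^ 3 + b₃' * g₀ * κ₂ * e₀ ^ 3 + 3 * g₁ * g₂ * κ₂ * e₀ ^ 3 + 3 * a₂ * g₁ * κ₁ * e₀ ^ 2 + 3 * b₂ * g₁ * κ₂ * e₀ ^ 3)) ≤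
      1048576 * κ₁ * g₃ * e₀ ^ 4) :
    3 * (3 * G₀ * k₂ * α₁ * b₂' + 3 * G₀ * k₃ * b₁ * b₂' + 6 * G₁ * k₂ * α₁ * b₁ + 3 * G₁ * k₃ * b₁ ^ 2 + G₀ * G₃ * k₂ + G₀ * k₂ * b₃' + 3 * G₁ * G₂ * k₂ + 3 * G₁ * k₁ * α₂ + 3 * G₁ * k₂ * b₂) ≤ k₁ * G₃ * x ^ 2 := by
  subst hk₁ hk₂ hk₃ hG₀ hG₁ hG₂ hG₃ hα₁ hα₂
  have he : 0 < e₀ := lt_of_lt_of_le hΛ hΛe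
  have t0 : (3 * a₁ * b₂' * g₀ * κ₂) * u ^ 3 * Λ ^ 2 ≤ (3 * a₁ * b₂' * g₀ * κ₂ * e₀ ^ 2) * u ^ 3 :=
    le_of_le_of_eq (mul_le_mul (mul_le_mul_of_nonneg_left (pow_le_pow_of_le_one hu0.le hu1 (show (3 : ℕ) ≤ 3 by norm_num)) (by positivity))
      (pow_le_pow_left₀ hΛ.le hΛe 2) (by positivity) (by positivity)) (by ring)
  have t1 : (3 * b₁ * b₂' * g₀ * κ₃) * u ^ 3 * Λ ^ 2 ≤ (3 * b₁ * b₂' * g₀ * κ₃ * e₀ ^ 2) * u ^ 3 :=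
    le_of_le_of_eq (mul_le_mul (mul_le_mul_of_nonneg_left (pow_le_pow_of_le_one hu0.le hu1 (show (3 : ℕ) ≤ 3 by norm_num)) (by positivity))
      (pow_le_pow_left₀ hΛ.le hΛe 2) (by positivity) (by positivity)) (by ring)
  have t2 : (6 * a₁ * b₁ * g₁ * κ₂) * u ^ 4 * Λ ^ 2 ≤ (6 * a₁ * b₁ * g₁ * κ₂ * e₀ ^ 2) * u ^ 3 :=
    le_of_le_of_eq (mul_le_mul (mul_le_mul_of_nonneg_left (pow_le_pow_of_le_one hu0.le hu1 (show (3 : ℕ) ≤ 4 by norm_num)) (by positivity))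
      (pow_le_pow_left₀ hΛ.le hΛe 2) (by positivity) (by positivity)) (by ring)
  have t3 : (3 * b₁ ^ 2 * g₁ * κ₃) * u ^ 4 * Λ ^ 2 ≤ (3 * b₁ ^ 2 * g₁ * κ₃ * e₀ ^ 2) * u ^ 3 :=
    le_of_le_of_eq (mul_le_mul (mul_le_mul_of_nonneg_left (pow_le_pow_of_le_one hu0.le hu1 (show (3 : ℕ) ≤ 4 by norm_num)) (by positivity))
      (pow_le_pow_left₀ hΛ.le hΛe 2) (by positivity) (by positivity)) (by ring)
  have t4 : (g₀ * g₃ * κ₂) * u ^ 5 * Λ ^ 3 ≤ (g₀ * g₃ * κ₂ * e₀ ^ 3) * u ^ 3 :=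
    le_of_le_of_eq (mul_le_mul (mul_le_mul_of_nonneg_left (pow_le_pow_of_le_one hu0.le hu1 (show (3 : ℕ) ≤ 5 by norm_num)) (by positivity))
      (pow_le_pow_left₀ hΛ.le hΛe 3) (by positivity) (by positivity)) (by ring)
  have t5 : (b₃' * g₀ * κ₂) * u ^ 3 * Λ ^ 3 ≤ (b₃' * g₀ * κ₂ * e₀ ^ 3) * u ^ 3 :=
    le_of_le_of_eq (mul_le_mul (mul_le_mul_of_nonneg_left (pow_le_pow_of_le_one hu0.le hu1 (show (3 : ℕ) ≤ 3 by norm_num)) (by positivity))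
      (pow_le_pow_left₀ hΛ.le hΛe 3) (by positivity) (by positivity)) (by ring)
  have t6 : (3 * g₁ * g₂ * κ₂) * u ^ 6 * Λ ^ 3 ≤ (3 * g₁ * g₂ * κ₂ * e₀ ^ 3) * u ^ 3 :=
    le_of_le_of_eq (mul_le_mul (mul_le_mul_of_nonneg_left (pow_le_pow_of_le_one hu0.le hu1 (show (3 : ℕ) ≤ 6 by norm_num)) (by positivity))
      (pow_le_pow_left₀ hΛ.le hΛe 3) (by positivity) (by positivity)) (by ring)
  have t7 : (3 * a₂ * g₁ * κ₁) * u ^ 4 * Λ ^ 2 ≤ (3 * a₂ * g₁ * κ₁ * e₀ ^ 2) * u ^ 3 :=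
    le_of_le_of_eq (mul_le_mul (mul_le_mul_of_nonneg_left (pow_le_pow_of_le_one hu0.le hu1 (show (3 : ℕ) ≤ 4 by norm_num)) (by positivity))
      (pow_le_pow_left₀ hΛ.le hΛe 2) (by positivity) (by positivity)) (by ring)
  have t8 : (3 * b₂ * g₁ * κ₂) * u ^ 4 * Λ ^ 3 ≤ (3 * b₂ * g₁ * κ₂ * e₀ ^ 3) * u ^ 3 :=
    le_of_le_of_eq (mul_le_mul (mul_le_mul_of_nonneg_left (pow_le_pow_of_le_one hu0.le hu1 (show (3 : ℕ) ≤ 4 by norm_num)) (by positivity))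
      (pow_le_pow_left₀ hΛ.le hΛe 3) (by positivity) (by positivity)) (by ring)
  have hS : (3 * (g₀ * u) * (κ₂ / Λ ^ 3) * (a₁ / Λ) * b₂' + 3 * (g₀ * u) * (κ₃ / Λ ^ 4) * b₁ * b₂' + 6 * (g₁ * u ^ 2) * (κ₂ / Λ ^ 3) * (a₁ / Λ) * b₁ + 3 * (g₁ * u ^ 2) * (κ₃ / Λ ^ 4) * b₁ ^ 2 + (g₀ * u) * (g₃ * u ^ 2) * (κ₂ / Λ ^ 3) + (g₀ * u) * (κ₂ / Λ ^ 3) * b₃' + 3 * (g₁ * u ^ 2) * (g₂ * u ^ 2) * (κ₂ / Λ ^ 3) + 3 * (g₁ * u ^ 2) * (κ₁ / Λ ^ 2) * (a₂ / Λ ^ 2) + 3 * (g₁ * u ^ 2) * (κ₂ / Λ ^ 3) * b₂) * (u ^ 2 * Λ ^ 6) ≤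
      (3 * a₁ * b₂' * g₀ * κ₂ * e₀ ^ 2 + 3 * b₁ * b₂' * g₀ * κ₃ * e₀ ^ 2 + 6 * a₁ * b₁ * g₁ * κ₂ * e₀ ^ 2 + 3 * b₁ ^ 2 * g₁ * κ₃ * e₀ ^ 2 + g₀ * g₃ * κ₂ * e₀ ^ 3 + b₃' * g₀ * κ₂ * e₀ ^ 3 + 3 * g₁ * g₂ * κ₂ * e₀ ^ 3 + 3 * a₂ * g₁ * κ₁ * e₀ ^ 2 + 3 * b₂ * g₁ * κ₂ * e₀ ^ 3) * u ^ 3 := by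
    have e : (3 * (g₀ * u) * (κ₂ / Λ ^ 3) * (a₁ / Λ) * b₂' + 3 * (g₀ * u) * (κ₃ / Λ ^ 4) * b₁ * b₂' + 6 * (g₁ * u ^ 2) * (κ₂ / Λ ^ 3) * (a₁ / Λ) * b₁ + 3 * (g₁ * u ^ 2) * (κ₃ / Λ ^ 4) * b₁ ^ 2 + (g₀ * u) * (g₃ * u ^ 2) * (κ₂ / Λ ^ 3) + (g₀ * u) * (κ₂ / Λ ^ 3) * b₃' + 3 * (g₁ * u ^ 2) * (g₂ * u ^ 2) * (κ₂ / Λ ^ 3) + 3 * (g₁ * u ^ 2) * (κ₁ / Λ ^ 2) * (a₂ / Λ ^ 2) + 3 * (g₁ * u ^ 2) * (κ₂ / Λ ^ 3) * b₂) * (u ^ 2 * Λ ^ 6) =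
        (3 * a₁ * b₂' * g₀ * κ₂) * u ^ 3 * Λ ^ 2 + (3 * b₁ * b₂' * g₀ * κ₃) * u ^ 3 * Λ ^ 2 + (6 * a₁ * b₁ * g₁ * κ₂) * u ^ 4 * Λ ^ 2 + (3 * b₁ ^ 2 * g₁ * κ₃) * u ^ 4 * Λ ^ 2 + (g₀ * g₃ * κ₂) * u ^ 5 * Λ ^ 3 + (b₃' * g₀ * κ₂) * u ^ 3 * Λ ^ 3 + (3 * g₁ * g₂ * κ₂) * u ^ 6 * Λ ^ 3 + (3 * a₂ * g₁ * κ₁) * u ^ 4 * Λ ^ 2 + (3 * b₂ * g₁ * κ₂) * u ^ 4 * Λ ^ 3 := by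
      field_simp
    rw [e]
    linarith only [t0, t1, t2, t3, t4, t5, t6, t7, t8]
  have hT : 1048576 * κ₁ * g₃ * e₀ ^ 4 * u ^ 2 ≤ (κ₁ / Λ ^ 2) * (g₃ * u ^ 2) * x ^ 2 * (u ^ 2 * Λ ^ 6) := by
    have hxi : (1024 * e₀ ^ 2) ^ 2 ≤ (x * (u * Λ ^ 2)) ^ 2 := pow_le_pow_left₀ (by positivity) hx 2
    calc 1048576 * κ₁ * g₃ * e₀ ^ 4 * u ^ 2 = κ₁ * g₃ * u ^ 2 * (1024 * e₀ ^ 2) ^ 2 := by ring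
      _ ≤ κ₁ * g₃ * u ^ 2 * (x * (u * Λ ^ 2)) ^ 2 := mul_le_mul_of_nonneg_left hxi (by positivity)
      _ = (κ₁ / Λ ^ 2) * (g₃ * u ^ 2) * x ^ 2 * (u ^ 2 * Λ ^ 6) := by field_simp
  have hw : 0 < (u ^ 2 * Λ ^ 6) := by positivity
  refine le_of_mul_le_mul_right ?_ hw
  calc 3 * (3 * (g₀ * u) * (κ₂ / Λ ^ 3) * (a₁ / Λ) * b₂' + 3 * (g₀ * u) * (κ₃ / Λ ^ 4) * b₁ * b₂' + 6 * (g₁ * u ^ 2) * (κ₂ / Λ ^ 3) * (a₁ / Λ) * b₁ + 3 * (g₁ * u ^ 2) * (κ₃ / Λ ^ 4) * b₁ ^ 2 + (g₀ * u) * (g₃ * u ^ 2) * (κ₂ / Λ ^ 3) + (g₀ * u) * (κ₂ / Λ ^ 3) * b₃' + 3 * (g₁ * u ^ 2) * (g₂ * u ^ 2) * (κ₂ / Λ ^ 3) + 3 * (g₁ * u ^ 2) * (κ₁ / Λ ^ 2) * (a₂ / Λ ^ 2) + 3 * (g₁ * u ^ 2) * (κ₂ / Λ ^ 3) * b₂)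 * (u ^ 2 * Λ ^ 6) = 3 * ((3 * (g₀ * u) * (κ₂ / Λ ^ 3) * (a₁ / Λ) * b₂' + 3 * (g₀ * u) * (κ₃ / Λ ^ 4) * b₁ * b₂' + 6 * (g₁ * u ^ 2) * (κ₂ / Λ ^ 3) * (a₁ / Λ) * b₁ + 3 * (g₁ * u ^ 2) * (κ₃ / Λ ^ 4) * b₁ ^ 2 + (g₀ * u) * (g₃ * u ^ 2) * (κ₂ / Λ ^ 3) + (g₀ * u) * (κ₂ / Λ ^ 3) * b₃' + 3 * (g₁ * u ^ 2) * (g₂ * u ^ 2) * (κ₂ / Λ ^ 3) + 3 * (g₁ * u ^ 2) * (κ₁ / Λ ^ 2) * (a₂ / Λ ^ 2) + 3 * (g₁ * u ^ 2) * (κ₂ / Λ ^ 3) * b₂) * (u ^ 2 * Λ ^ 6)) := by ring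
    _ ≤ 3 * ((3 * a₁ * b₂' * g₀ * κ₂ * e₀ ^ 2 + 3 * b₁ * b₂' * g₀ * κ₃ * e₀ ^ 2 + 6 * a₁ * b₁ * g₁ * κ₂ * e₀ ^ 2 + 3 * b₁ ^ 2 * g₁ * κ₃ * e₀ ^ 2 + g₀ * g₃ * κ₂ * e₀ ^ 3 + b₃' * g₀ * κ₂ * e₀ ^ 3 + 3 * g₁ * g₂ * κ₂ * e₀ ^ 3 + 3 * a₂ * g₁ * κ₁ * e₀ ^ 2 + 3 * b₂ * g₁ * κ₂ * e₀ ^ 3) * u ^ 3) := mul_le_mul_of_nonneg_left hS (by norm_num)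
    _ = u ^ 2 * (3 * (u * (3 * a₁ * b₂' * g₀ * κ₂ * e₀ ^ 2 + 3 * b₁ * b₂' * g₀ * κ₃ * e₀ ^ 2 + 6 * a₁ * b₁ * g₁ * κ₂ * e₀ ^ 2 + 3 * b₁ ^ 2 * g₁ * κ₃ * e₀ ^ 2 + g₀ * g₃ * κ₂ * e₀ ^ 3 + b₃' * g₀ * κ₂ * e₀ ^ 3 + 3 * g₁ * g₂ * κ₂ * e₀ ^ 3 + 3 * a₂ * g₁ * κ₁ * e₀ ^ 2 + 3 * b₂ * g₁ * κ₂ * e₀ ^ 3))) := by ring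
    _ ≤ u ^ 2 * (1048576 * κ₁ * g₃ * e₀ ^ 4) := mul_le_mul_of_nonneg_left hU (by positivity)
    _ = 1048576 * κ₁ * g₃ * e₀ ^ 4 * u ^ 2 := by ring
    _ ≤ (κ₁ / Λ ^ 2) * (g₃ * u ^ 2) * x ^ 2 * (u ^ 2 * Λ ^ 6) := hT

set_option maxHeartbeats 400000 in
/-- **Threshold `X3` at the SHALLOW (c-D) depth** (twin of `cd_threshold_X3`): `3·X3 ≤ k₁G₃·x^3`
for every depth `x` with `1024e₀² ≤ x·u·Λ²` (ONE power of `u`) under the SAME `u`-smallness condition as at the deep base (multiplier `u^3Λ^8`). -/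
theorem cd_threshold_X3_lin {{κ₁ κ₂ κ₃ κ₄ g₀ g₁ g₂ g₃ a₁ a₂ a₃ b₁ b₂ b₂' b₃ e₀ Λ u x k₁ k₂ k₃ k₄ G₀ G₁ G₂ G₃ α₁ α₂ α₃ : ℝ}}
    (hκ₁ : 0 ≤ κ₁) (hκ₂ : 0 ≤ κ₂) (hκ₃ : 0 ≤ κ₃) (hκ₄ : 0 ≤ κ₄) (hg₀ : 0 ≤ g₀) (hg₁ : 0 ≤ g₁) (hg₂ : 0 ≤ g₂) (hg₃ : 0 ≤ g₃) (ha₁ : 0 ≤ a₁) (ha₂ : 0 ≤ a₂) (ha₃ : 0 ≤ a₃) (hb₁ : 0 ≤ b₁) (hb₂ : 0 ≤ b₂) (hb₂' : 0 ≤ b₂') (hb₃ : 0 ≤ b₃)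
    (hΛ : 0 < Λ) (hΛe : Λ ≤ e₀) (hu0 : 0 < u) (hu1 : u ≤ 1) (hx : 1024 * e₀ ^ 2 ≤ x * (u * Λ ^ 2))
    (hk₁ : k₁ = κ₁ / Λ ^ 2) (hk₂ : k₂ = κ₂ / Λ ^ 3) (hk₃ : k₃ = κ₃ / Λ ^ 4) (hk₄ : k₄ = κ₄ / Λ ^ 5) (hG₀ : G₀ = g₀ * u) (hG₁ : G₁ = g₁ * u ^ 2) (hG₂ : G₂ = g₂ * u ^ 2) (hG₃ : G₃ = g₃ * u ^ 2) (hα₁ : α₁ = a₁ / Λ) (hα₂ : α₂ = a₂ / Λ ^ 2) (hα₃ : α₃ = a₃ / Λ ^ 3)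
    (hU : 3 * (u * (3 * a₁ * b₁ ^ 2 * g₀ * κ₃ * e₀ ^ 3 + b₁ ^ 3 * g₀ * κ₄ * e₀ ^ 3 + 3 * b₂' * g₀ * g₁ * κ₃ * e₀ ^ 4 + 3 * a₁ * g₀ * g₂ * κ₂ * e₀ ^ 4 + 3 * b₁ * g₀ * g₂ * κ₃ * e₀ ^ 4 + 3 * a₁ * b₂ * g₀ * κ₂ * e₀ ^ 4 + 3 * a₂ * b₁ * g₀ * κ₂ * e₀ ^ 3 + 3 * b₁ * b₂ * g₀ * κ₃ * e₀ ^ 4 + 3 * a₁ * g₁ ^ 2 * κ₂ * e₀ ^ 4 + 3 * b₁ * g₁ ^ 2 * κ₃ * e₀ ^ 4 + a₃ * g₀ * κ₁ * e₀ ^ 3 + b₃ * g₀ * κ₂ * e₀ ^ 5 + 6 * a₁ * b₁ * g₀ * g₁ * κ₃ * e₀ ^ 3 + 3 * b₁ ^ 2 * g₀ * g₁ * κ₄ * e₀ ^ 3 + 3 * g₀ * g₁ * g₂ * κ₃ * e₀ ^ 4 + 3 * a₂ * g₀ * g₁ * κ₂ * e₀ ^ 3 + 3 * b₂ * g₀ *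 g₁ * κ₃ * e₀ ^ 4 + g₁ ^ 3 * κ₃ * e₀ ^ 4 + 3 * a₁ * g₀ * g₁ ^ 2 * κ₃ * e₀ ^ 3 + 3 * b₁ * g₀ * g₁ ^ 2 * κ₄ * e₀ ^ 3 + g₀ * g₁ ^ 3 * κ₄ * e₀ ^ 3)) ≤
      1073741824 * κ₁ * g₃ * e₀ ^ 6) :
    3 * ((3 * G₀ * k₃ * α₁ * b₁ ^ 2 + G₀ * k₄ * b₁ ^ 3 + 3 * G₀ * G₁ * k₃ * b₂' + 3 * G₀ * G₂ * k₂ * α₁ + 3 * G₀ * G₂ * k₃ * b₁ + 3 * G₀ * k₂ * α₁ * b₂ + 3 * G₀ * k₂ * α₂ * b₁ + 3 * G₀ * k₃ * b₁ * b₂ + 3 * G₁ ^ 2 * k₂ * α₁ + 3 * G₁ ^ 2 * k₃ * b₁ + G₀ * k₁ * α₃ + G₀ * k₂ * b₃) + (6 * G₀ * G₁ * k₃ * α₁ * b₁ + 3 * G₀ * G₁ * k₄ * b₁ ^ 2 + 3 * G₀ * G₁ * G₂ * k₃ + 3 * G₀ * G₁ * k₂ * α₂ + 3 * G₀ * G₁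 * k₃ * b₂ + G₁ ^ 3 * k₃) + (3 * G₀ * G₁ ^ 2 * k₃ * α₁ + 3 * G₀ * G₁ ^ 2 * k₄ * b₁) + (G₀ * G₁ ^ 3 * k₄)) ≤ k₁ * G₃ * x ^ 3 := by
  subst hk₁ hk₂ hk₃ hk₄ hG₀ hG₁ hG₂ hG₃ hα₁ hα₂ hα₃
  have he : 0 < e₀ := lt_of_lt_of_le hΛ hΛe
  have t0 : (3 * a₁ * b₁ ^ 2 * g₀ * κ₃) * u ^ 4 * Λ ^ 3 ≤ (3 * a₁ * b₁ ^ 2 * g₀ * κ₃ * e₀ ^ 3) * u ^ 3 :=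
    le_of_le_of_eq (mul_le_mul (mul_le_mul_of_nonneg_left (pow_le_pow_of_le_one hu0.le hu1 (show (3 : ℕ) ≤ 4 by norm_num)) (by positivity))
      (pow_le_pow_left₀ hΛ.le hΛe 3) (by positivity) (by positivity)) (by ring)
  have t1 : (b₁ ^ 3 * g₀ * κ₄) * u ^ 4 * Λ ^ 3 ≤ (b₁ ^ 3 * g₀ * κ₄ * e₀ ^ 3) * u ^ 3 :=
    le_of_le_of_eq (mul_le_mul (mul_le_mul_of_nonneg_left (pow_le_pow_of_le_one hu0.le hu1 (show (3 : ℕ) ≤ 4 by norm_num)) (by positivity))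
      (pow_le_pow_left₀ hΛ.le hΛe 3) (by positivity) (by positivity)) (by ring)
  have t2 : (3 * b₂' * g₀ * g₁ * κ₃) * u ^ 6 * Λ ^ 4 ≤ (3 * b₂' * g₀ * g₁ * κ₃ * e₀ ^ 4) * u ^ 3 :=
    le_of_le_of_eq (mul_le_mul (mul_le_mul_of_nonneg_left (pow_le_pow_of_le_one hu0.le hu1 (show (3 : ℕ) ≤ 6 by norm_num)) (by positivity))
      (pow_le_pow_left₀ hΛ.le hΛe 4) (by positivity) (by positivity)) (by ring)
  have t3 : (3 * a₁ * g₀ * g₂ * κ₂) * u ^ 6 * Λ ^ 4 ≤ (3 * a₁ * g₀ * g₂ * κ₂ * e₀ ^ 4) * u ^ 3 :=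
    le_of_le_of_eq (mul_le_mul (mul_le_mul_of_nonneg_left (pow_le_pow_of_le_one hu0.le hu1 (show (3 : ℕ) ≤ 6 by norm_num)) (by positivity))
      (pow_le_pow_left₀ hΛ.le hΛe 4) (by positivity) (by positivity)) (by ring)
  have t4 : (3 * b₁ * g₀ * g₂ * κ₃) * u ^ 6 * Λ ^ 4 ≤ (3 * b₁ * g₀ * g₂ * κ₃ * e₀ ^ 4) * u ^ 3 :=
    le_of_le_of_eq (mul_le_mul (mul_le_mul_of_nonneg_left (pow_le_pow_of_le_one hu0.le hu1 (show (3 : ℕ) ≤ 6 by norm_num)) (by positivity))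
      (pow_le_pow_left₀ hΛ.le hΛe 4) (by positivity) (by positivity)) (by ring)
  have t5 : (3 * a₁ * b₂ * g₀ * κ₂) * u ^ 4 * Λ ^ 4 ≤ (3 * a₁ * b₂ * g₀ * κ₂ * e₀ ^ 4) * u ^ 3 :=
    le_of_le_of_eq (mul_le_mul (mul_le_mul_of_nonneg_left (pow_le_pow_of_le_one hu0.le hu1 (show (3 : ℕ) ≤ 4 by norm_num)) (by positivity))
      (pow_le_pow_left₀ hΛ.le hΛe 4) (by positivity) (by positivity)) (by ring)
  have t6 : (3 * a₂ * b₁ * g₀ * κ₂) * u ^ 4 * Λ ^ 3 ≤ (3 * a₂ * b₁ * g₀ * κ₂ * e₀ ^ 3) * u ^ 3 :=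
    le_of_le_of_eq (mul_le_mul (mul_le_mul_of_nonneg_left (pow_le_pow_of_le_one hu0.le hu1 (show (3 : ℕ) ≤ 4 by norm_num)) (by positivity))
      (pow_le_pow_left₀ hΛ.le hΛe 3) (by positivity) (by positivity)) (by ring)
  have t7 : (3 * b₁ * b₂ * g₀ * κ₃) * u ^ 4 * Λ ^ 4 ≤ (3 * b₁ * b₂ * g₀ * κ₃ * e₀ ^ 4) * u ^ 3 :=
    le_of_le_of_eq (mul_le_mul (mul_le_mul_of_nonneg_left (pow_le_pow_of_le_one hu0.le hu1 (show (3 : ℕ) ≤ 4 by norm_num)) (by positivity))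
      (pow_le_pow_left₀ hΛ.le hΛe 4) (by positivity) (by positivity)) (by ring)
  have t8 : (3 * a₁ * g₁ ^ 2 * κ₂) * u ^ 7 * Λ ^ 4 ≤ (3 * a₁ * g₁ ^ 2 * κ₂ * e₀ ^ 4) * u ^ 3 :=
    le_of_le_of_eq (mul_le_mul (mul_le_mul_of_nonneg_left (pow_le_pow_of_le_one hu0.le hu1 (show (3 : ℕ) ≤ 7 by norm_num)) (by positivity))
      (pow_le_pow_left₀ hΛ.le hΛe 4) (by positivity) (by positivity)) (by ring)
  have t9 : (3 * b₁ * g₁ ^ 2 * κ₃) * u ^ 7 * Λ ^ 4 ≤ (3 * b₁ * g₁ ^ 2 * κ₃ * e₀ ^ 4) * u ^ 3 :=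
    le_of_le_of_eq (mul_le_mul (mul_le_mul_of_nonneg_left (pow_le_pow_of_le_one hu0.le hu1 (show (3 : ℕ) ≤ 7 by norm_num)) (by positivity))
      (pow_le_pow_left₀ hΛ.le hΛe 4) (by positivity) (by positivity)) (by ring)
  have t10 : (a₃ * g₀ * κ₁) * u ^ 4 * Λ ^ 3 ≤ (a₃ * g₀ * κ₁ * e₀ ^ 3) * u ^ 3 :=
    le_of_le_of_eq (mul_le_mul (mul_le_mul_of_nonneg_left (pow_le_pow_of_le_one hu0.le hu1 (show (3 : ℕ) ≤ 4 by norm_num)) (by positivity))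
      (pow_le_pow_left₀ hΛ.le hΛe 3) (by positivity) (by positivity)) (by ring)
  have t11 : (b₃ * g₀ * κ₂) * u ^ 4 * Λ ^ 5 ≤ (b₃ * g₀ * κ₂ * e₀ ^ 5) * u ^ 3 :=
    le_of_le_of_eq (mul_le_mul (mul_le_mul_of_nonneg_left (pow_le_pow_of_le_one hu0.le hu1 (show (3 : ℕ) ≤ 4 by norm_num)) (by positivity))
      (pow_le_pow_left₀ hΛ.le hΛe 5) (by positivity) (by positivity)) (by ring)
  have t12 : (6 * a₁ * b₁ * g₀ * g₁ * κ₃) * u ^ 6 * Λ ^ 3 ≤ (6 * a₁ * b₁ * g₀ * g₁ * κ₃ * e₀ ^ 3) * u ^ 3 :=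
    le_of_le_of_eq (mul_le_mul (mul_le_mul_of_nonneg_left (pow_le_pow_of_le_one hu0.le hu1 (show (3 : ℕ) ≤ 6 by norm_num)) (by positivity))
      (pow_le_pow_left₀ hΛ.le hΛe 3) (by positivity) (by positivity)) (by ring)
  have t13 : (3 * b₁ ^ 2 * g₀ * g₁ * κ₄) * u ^ 6 * Λ ^ 3 ≤ (3 * b₁ ^ 2 * g₀ * g₁ * κ₄ * e₀ ^ 3) * u ^ 3 :=
    le_of_le_of_eq (mul_le_mul (mul_le_mul_of_nonneg_left (pow_le_pow_of_le_one hu0.le hu1 (show (3 : ℕ) ≤ 6 by norm_num)) (by positivity))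
      (pow_le_pow_left₀ hΛ.le hΛe 3) (by positivity) (by positivity)) (by ring)
  have t14 : (3 * g₀ * g₁ * g₂ * κ₃) * u ^ 8 * Λ ^ 4 ≤ (3 * g₀ * g₁ * g₂ * κ₃ * e₀ ^ 4) * u ^ 3 :=
    le_of_le_of_eq (mul_le_mul (mul_le_mul_of_nonneg_left (pow_le_pow_of_le_one hu0.le hu1 (show (3 : ℕ) ≤ 8 by norm_num)) (by positivity))
      (pow_le_pow_left₀ hΛ.le hΛe 4) (by positivity) (by positivity)) (by ring)
  have t15 : (3 * a₂ * g₀ * g₁ * κ₂) * u ^ 6 * Λ ^ 3 ≤ (3 * a₂ * g₀ * g₁ * κ₂ * e₀ ^ 3) * u ^ 3 :=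
    le_of_le_of_eq (mul_le_mul (mul_le_mul_of_nonneg_left (pow_le_pow_of_le_one hu0.le hu1 (show (3 : ℕ) ≤ 6 by norm_num)) (by positivity))
      (pow_le_pow_left₀ hΛ.le hΛe 3) (by positivity) (by positivity)) (by ring)
  have t16 : (3 * b₂ * g₀ * g₁ * κ₃) * u ^ 6 * Λ ^ 4 ≤ (3 * b₂ * g₀ * g₁ * κ₃ * e₀ ^ 4) * u ^ 3 :=
    le_of_le_of_eq (mul_le_mul (mul_le_mul_of_nonneg_left (pow_le_pow_of_le_one hu0.le hu1 (show (3 : ℕ) ≤ 6 by norm_num)) (by positivity))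
      (pow_le_pow_left₀ hΛ.le hΛe 4) (by positivity) (by positivity)) (by ring)
  have t17 : (g₁ ^ 3 * κ₃) * u ^ 9 * Λ ^ 4 ≤ (g₁ ^ 3 * κ₃ * e₀ ^ 4) * u ^ 3 :=
    le_of_le_of_eq (mul_le_mul (mul_le_mul_of_nonneg_left (pow_le_pow_of_le_one hu0.le hu1 (show (3 : ℕ) ≤ 9 by norm_num)) (by positivity))
      (pow_le_pow_left₀ hΛ.le hΛe 4) (by positivity) (by positivity)) (by ring)
  have t18 : (3 * a₁ * g₀ * g₁ ^ 2 * κ₃) * u ^ 8 * Λ ^ 3 ≤ (3 * a₁ * g₀ * g₁ ^ 2 * κ₃ * e₀ ^ 3) * u ^ 3 :=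
    le_of_le_of_eq (mul_le_mul (mul_le_mul_of_nonneg_left (pow_le_pow_of_le_one hu0.le hu1 (show (3 : ℕ) ≤ 8 by norm_num)) (by positivity))
      (pow_le_pow_left₀ hΛ.le hΛe 3) (by positivity) (by positivity)) (by ring)
  have t19 : (3 * b₁ * g₀ * g₁ ^ 2 * κ₄) * u ^ 8 * Λ ^ 3 ≤ (3 * b₁ * g₀ * g₁ ^ 2 * κ₄ * e₀ ^ 3) * u ^ 3 :=
    le_of_le_of_eq (mul_le_mul (mul_le_mul_of_nonneg_left (pow_le_pow_of_le_one hu0.le hu1 (show (3 : ℕ) ≤ 8 by norm_num)) (by positivity))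
      (pow_le_pow_left₀ hΛ.le hΛe 3) (by positivity) (by positivity)) (by ring)
  have t20 : (g₀ * g₁ ^ 3 * κ₄) * u ^ 10 * Λ ^ 3 ≤ (g₀ * g₁ ^ 3 * κ₄ * e₀ ^ 3) * u ^ 3 :=
    le_of_le_of_eq (mul_le_mul (mul_le_mul_of_nonneg_left (pow_le_pow_of_le_one hu0.le hu1 (show (3 : ℕ) ≤ 10 by norm_num)) (by positivity))
      (pow_le_pow_left₀ hΛ.le hΛe 3) (by positivity) (by positivity)) (by ring)
  have hS : ((3 * (g₀ * u) * (κ₃ / Λ ^ 4) * (a₁ / Λ) * b₁ ^ 2 + (g₀ * u) * (κ₄ / Λ ^ 5) * b₁ ^ 3 + 3 * (g₀ * u) * (g₁ * u ^ 2) * (κ₃ / Λ ^ 4) * b₂' + 3 * (g₀ * u) * (g₂ * u ^ 2) * (κ₂ / Λ ^ 3) * (a₁ / Λ) + 3 * (g₀ * u) * (g₂ * u ^ 2) * (κ₃ / Λ ^ 4) * b₁ + 3 * (g₀ * u) * (κ₂ / Λ ^ 3) * (a₁ / Λ) * b₂ + 3 * (g₀ * u) * (κ₂ / Λ ^ 3)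 * (a₂ / Λ ^ 2) * b₁ + 3 * (g₀ * u) * (κ₃ / Λ ^ 4) * b₁ * b₂ + 3 * (g₁ * u ^ 2) ^ 2 * (κ₂ / Λ ^ 3) * (a₁ / Λ) + 3 * (g₁ * u ^ 2) ^ 2 * (κ₃ / Λ ^ 4) * b₁ + (g₀ * u) * (κ₁ / Λ ^ 2) * (a₃ / Λ ^ 3) + (g₀ * u) * (κ₂ / Λ ^ 3) * b₃) + (6 * (g₀ * u) * (g₁ * u ^ 2) * (κ₃ / Λ ^ 4) * (a₁ / Λ) * b₁ + 3 * (g₀ * u) * (g₁ * u ^ 2) * (κ₄ / Λ ^ 5) * b₁ ^ 2 + 3 * (g₀ * u) * (g₁ * u ^ 2) * (g₂ * u ^ 2) * (κ₃ / Λ ^ 4) + 3 * (g₀ * u) * (g₁ * u ^ 2) * (κ₂ / Λ ^ 3) * (a₂ / Λ ^ 2) + 3 * (g₀ * u) * (g₁ * u ^ 2) * (κ₃ / Λ ^ 4) * b₂ + (g₁ * u ^ 2) ^ 3 * (κ₃ / Λ ^ 4)) + (3 * (g₀ * u) * (g₁ * u ^ 2) ^ 2 * (κ₃ / Λ ^ 4)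 * (a₁ / Λ) + 3 * (g₀ * u) * (g₁ * u ^ 2) ^ 2 * (κ₄ / Λ ^ 5) * b₁) + ((g₀ * u) * (g₁ * u ^ 2) ^ 3 * (κ₄ / Λ ^ 5))) * (u ^ 3 * Λ ^ 8) ≤
      (3 * a₁ * b₁ ^ 2 * g₀ * κ₃ * e₀ ^ 3 + b₁ ^ 3 * g₀ * κ₄ * e₀ ^ 3 + 3 * b₂' * g₀ * g₁ * κ₃ * e₀ ^ 4 + 3 * a₁ * g₀ * g₂ * κ₂ * e₀ ^ 4 + 3 * b₁ * g₀ * g₂ * κ₃ * e₀ ^ 4 + 3 * a₁ * b₂ * g₀ * κ₂ * e₀ ^ 4 + 3 * a₂ * b₁ * g₀ * κ₂ * e₀ ^ 3 + 3 * b₁ * b₂ * g₀ * κ₃ * e₀ ^ 4 + 3 * a₁ * g₁ ^ 2 * κ₂ * e₀ ^ 4 + 3 * b₁ * g₁ ^ 2 * κ₃ * e₀ ^ 4 + a₃ * g₀ * κ₁ * e₀ ^ 3 + b₃ * g₀ * κ₂ * e₀ ^ 5 + 6 * a₁ * b₁ * g₀ * g₁ * κ₃ * e₀ ^ 3 + 3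 * b₁ ^ 2 * g₀ * g₁ * κ₄ * e₀ ^ 3 + 3 * g₀ * g₁ * g₂ * κ₃ * e₀ ^ 4 + 3 * a₂ * g₀ * g₁ * κ₂ * e₀ ^ 3 + 3 * b₂ * g₀ * g₁ * κ₃ * e₀ ^ 4 + g₁ ^ 3 * κ₃ * e₀ ^ 4 + 3 * a₁ * g₀ * g₁ ^ 2 * κ₃ * e₀ ^ 3 + 3 * b₁ * g₀ * g₁ ^ 2 * κ₄ * e₀ ^ 3 + g₀ * g₁ ^ 3 * κ₄ * e₀ ^ 3) * u ^ 3 := by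
    have e : ((3 * (g₀ * u) * (κ₃ / Λ ^ 4) * (a₁ / Λ) * b₁ ^ 2 + (g₀ * u) * (κ₄ / Λ ^ 5) * b₁ ^ 3 + 3 * (g₀ * u) * (g₁ * u ^ 2) * (κ₃ / Λ ^ 4) * b₂' + 3 * (g₀ * u) * (g₂ * u ^ 2) * (κ₂ / Λ ^ 3) * (a₁ / Λ) + 3 * (g₀ * u) * (g₂ * u ^ 2) * (κ₃ / Λ ^ 4) * b₁ + 3 * (g₀ * u) * (κ₂ / Λ ^ 3) * (a₁ / Λ) * b₂ + 3 * (g₀ * u) * (κ₂ / Λ ^ 3) * (a₂ / Λ ^ 2) * b₁ + 3 * (g₀ * u) * (κ₃ / Λ ^ 4) * b₁ * b₂ + 3 * (g₁ * u ^ 2) ^ 2 * (κ₂ / Λ ^ 3) * (a₁ / Λ) + 3 * (g₁ * u ^ 2) ^ 2 * (κ₃ / Λ ^ 4) * b₁ + (g₀ * u) * (κ₁ / Λ ^ 2) * (a₃ / Λ ^ 3) + (g₀ * u) * (κ₂ / Λ ^ 3) * b₃) + (6 * (g₀ * u) * (g₁ * u ^ 2) * (κ₃ / Λ ^ 4) *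 (a₁ / Λ) * b₁ + 3 * (g₀ * u) * (g₁ * u ^ 2) * (κ₄ / Λ ^ 5) * b₁ ^ 2 + 3 * (g₀ * u) * (g₁ * u ^ 2) * (g₂ * u ^ 2) * (κ₃ / Λ ^ 4) + 3 * (g₀ * u) * (g₁ * u ^ 2) * (κ₂ / Λ ^ 3) * (a₂ / Λ ^ 2) + 3 * (g₀ * u) * (g₁ * u ^ 2) * (κ₃ / Λ ^ 4) * b₂ + (g₁ * u ^ 2) ^ 3 * (κ₃ / Λ ^ 4)) + (3 * (g₀ * u) * (g₁ * u ^ 2) ^ 2 * (κ₃ / Λ ^ 4) * (a₁ / Λ) + 3 * (g₀ * u) * (g₁ * u ^ 2) ^ 2 * (κ₄ / Λ ^ 5) * b₁) + ((g₀ * u) * (g₁ * u ^ 2) ^ 3 * (κ₄ / Λ ^ 5))) * (u ^ 3 * Λ ^ 8) =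
        (3 * a₁ * b₁ ^ 2 * g₀ * κ₃) * u ^ 4 * Λ ^ 3 + (b₁ ^ 3 * g₀ * κ₄) * u ^ 4 * Λ ^ 3 + (3 * b₂' * g₀ * g₁ * κ₃) * u ^ 6 * Λ ^ 4 + (3 * a₁ * g₀ * g₂ * κ₂) * u ^ 6 * Λ ^ 4 + (3 * b₁ * g₀ * g₂ * κ₃) * u ^ 6 * Λ ^ 4 + (3 * a₁ * b₂ * g₀ * κ₂) * u ^ 4 * Λ ^ 4 + (3 * a₂ * b₁ * g₀ * κ₂) * u ^ 4 * Λ ^ 3 + (3 * b₁ * b₂ * g₀ * κ₃) * u ^ 4 * Λ ^ 4 + (3 * a₁ * g₁ ^ 2 * κ₂) * u ^ 7 * Λ ^ 4 + (3 * b₁ * g₁ ^ 2 * κ₃) * u ^ 7 * Λ ^ 4 + (a₃ * g₀ * κ₁) * u ^ 4 * Λ ^ 3 + (b₃ * g₀ * κ₂) * u ^ 4 * Λ ^ 5 + (6 * a₁ * b₁ * g₀ * g₁ * κ₃) * u ^ 6 * Λ ^ 3 + (3 * b₁ ^ 2 * g₀ * g₁ * κ₄) * u ^ 6 * Λ ^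 3 + (3 * g₀ * g₁ * g₂ * κ₃) * u ^ 8 * Λ ^ 4 + (3 * a₂ * g₀ * g₁ * κ₂) * u ^ 6 * Λ ^ 3 + (3 * b₂ * g₀ * g₁ * κ₃) * u ^ 6 * Λ ^ 4 + (g₁ ^ 3 * κ₃) * u ^ 9 * Λ ^ 4 + (3 * a₁ * g₀ * g₁ ^ 2 * κ₃) * u ^ 8 * Λ ^ 3 + (3 * b₁ * g₀ * g₁ ^ 2 * κ₄) * u ^ 8 * Λ ^ 3 + (g₀ * g₁ ^ 3 * κ₄) * u ^ 10 * Λ ^ 3 := by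
      field_simp
      ring
    rw [e]
    linarith only [t0, t1, t2, t3, t4, t5, t6, t7, t8, t9, t10, t11, t12, t13, t14, t15, t16, t17, t18, t19, t20]
  have hT : 1073741824 * κ₁ * g₃ * e₀ ^ 6 * u ^ 2 ≤ (κ₁ / Λ ^ 2) * (g₃ * u ^ 2) * x ^ 3 * (u ^ 3 * Λ ^ 8) := by
    have hxi : (1024 * e₀ ^ 2) ^ 3 ≤ (x * (u * Λ ^ 2)) ^ 3 := pow_le_pow_left₀ (by positivity) hx 3
    calc 1073741824 * κ₁ * g₃ * e₀ ^ 6 * u ^ 2 = κ₁ * g₃ * u ^ 2 * (1024 * e₀ ^ 2) ^ 3 := by ring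
      _ ≤ κ₁ * g₃ * u ^ 2 * (x * (u * Λ ^ 2)) ^ 3 := mul_le_mul_of_nonneg_left hxi (by positivity)
      _ = (κ₁ / Λ ^ 2) * (g₃ * u ^ 2) * x ^ 3 * (u ^ 3 * Λ ^ 8) := by field_simp
  have hw : 0 < (u ^ 3 * Λ ^ 8) := by positivity
  refine le_of_mul_le_mul_right ?_ hw
  calc 3 * ((3 * (g₀ * u) * (κ₃ / Λ ^ 4) * (a₁ / Λ) * b₁ ^ 2 + (g₀ * u) * (κ₄ / Λ ^ 5) * b₁ ^ 3 + 3 * (g₀ * u) * (g₁ * u ^ 2) * (κ₃ / Λ ^ 4) * b₂' + 3 * (g₀ * u) * (g₂ * u ^ 2) * (κ₂ / Λ ^ 3) * (a₁ / Λ) + 3 * (g₀ * u) * (g₂ * u ^ 2) * (κ₃ / Λ ^ 4) * b₁ + 3 * (g₀ * u) * (κ₂ / Λ ^ 3) * (a₁ / Λ) * b₂ + 3 * (g₀ * u) * (κ₂ / Λ ^ 3) * (a₂ / Λ ^ 2) * b₁ + 3 * (g₀ * u) * (κ₃ / Λ ^ 4) * b₁ * b₂ + 3 * (g₁ * u ^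 2) ^ 2 * (κ₂ / Λ ^ 3) * (a₁ / Λ) + 3 * (g₁ * u ^ 2) ^ 2 * (κ₃ / Λ ^ 4) * b₁ + (g₀ * u) * (κ₁ / Λ ^ 2) * (a₃ / Λ ^ 3) + (g₀ * u) * (κ₂ / Λ ^ 3) * b₃) + (6 * (g₀ * u) * (g₁ * u ^ 2) * (κ₃ / Λ ^ 4) * (a₁ / Λ) * b₁ + 3 * (g₀ * u) * (g₁ * u ^ 2) * (κ₄ / Λ ^ 5) * b₁ ^ 2 + 3 * (g₀ * u) * (g₁ * u ^ 2) * (g₂ * u ^ 2) * (κ₃ / Λ ^ 4) + 3 * (g₀ * u) * (g₁ * u ^ 2) * (κ₂ / Λ ^ 3) * (a₂ / Λ ^ 2) + 3 * (g₀ * u) * (g₁ * u ^ 2) * (κ₃ / Λ ^ 4) * b₂ + (g₁ * u ^ 2) ^ 3 * (κ₃ / Λ ^ 4)) + (3 * (g₀ * u) * (g₁ * u ^ 2) ^ 2 * (κ₃ / Λ ^ 4) * (a₁ / Λ) + 3 * (g₀ * u) * (g₁ * u ^ 2) ^ 2 * (κ₄ / Λ ^ 5) * b₁) + ((g₀ *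 u) * (g₁ * u ^ 2) ^ 3 * (κ₄ / Λ ^ 5))) * (u ^ 3 * Λ ^ 8) = 3 * (((3 * (g₀ * u) * (κ₃ / Λ ^ 4) * (a₁ / Λ) * b₁ ^ 2 + (g₀ * u) * (κ₄ / Λ ^ 5) * b₁ ^ 3 + 3 * (g₀ * u) * (g₁ * u ^ 2) * (κ₃ / Λ ^ 4) * b₂' + 3 * (g₀ * u) * (g₂ * u ^ 2) * (κ₂ / Λ ^ 3) * (a₁ / Λ) + 3 * (g₀ * u) * (g₂ * u ^ 2) * (κ₃ / Λ ^ 4) * b₁ + 3 * (g₀ * u) * (κ₂ / Λ ^ 3) * (a₁ / Λ) * b₂ + 3 * (g₀ * u) * (κ₂ / Λ ^ 3) * (a₂ / Λ ^ 2) * b₁ + 3 * (g₀ * u) * (κ₃ / Λ ^ 4) * b₁ * b₂ + 3 * (g₁ * u ^ 2) ^ 2 * (κ₂ / Λ ^ 3) * (a₁ / Λ) + 3 * (g₁ * u ^ 2) ^ 2 * (κ₃ / Λ ^ 4) * b₁ + (g₀ * u) * (κ₁ / Λ ^ 2) * (a₃ / Λ ^ 3) + (g₀ * u) * (κ₂ /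 Λ ^ 3) * b₃) + (6 * (g₀ * u) * (g₁ * u ^ 2) * (κ₃ / Λ ^ 4) * (a₁ / Λ) * b₁ + 3 * (g₀ * u) * (g₁ * u ^ 2) * (κ₄ / Λ ^ 5) * b₁ ^ 2 + 3 * (g₀ * u) * (g₁ * u ^ 2) * (g₂ * u ^ 2) * (κ₃ / Λ ^ 4) + 3 * (g₀ * u) * (g₁ * u ^ 2) * (κ₂ / Λ ^ 3) * (a₂ / Λ ^ 2) + 3 * (g₀ * u) * (g₁ * u ^ 2) * (κ₃ / Λ ^ 4) * b₂ + (g₁ * u ^ 2) ^ 3 * (κ₃ / Λ ^ 4)) + (3 * (g₀ * u) * (g₁ * u ^ 2) ^ 2 * (κ₃ / Λ ^ 4) * (a₁ / Λ) + 3 * (g₀ * u) * (g₁ * u ^ 2) ^ 2 * (κ₄ / Λ ^ 5) * b₁) + ((g₀ * u) * (g₁ * u ^ 2) ^ 3 * (κ₄ / Λ ^ 5))) * (u ^ 3 * Λ ^ 8)) := by ring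
    _ ≤ 3 * ((3 * a₁ * b₁ ^ 2 * g₀ * κ₃ * e₀ ^ 3 + b₁ ^ 3 * g₀ * κ₄ * e₀ ^ 3 + 3 * b₂' * g₀ * g₁ * κ₃ * e₀ ^ 4 + 3 * a₁ * g₀ * g₂ * κ₂ * e₀ ^ 4 + 3 * b₁ * g₀ * g₂ * κ₃ * e₀ ^ 4 + 3 * a₁ * b₂ * g₀ * κ₂ * e₀ ^ 4 + 3 * a₂ * b₁ * g₀ * κ₂ * e₀ ^ 3 + 3 * b₁ * b₂ * g₀ * κ₃ * e₀ ^ 4 + 3 * a₁ * g₁ ^ 2 * κ₂ * e₀ ^ 4 + 3 * b₁ * g₁ ^ 2 * κ₃ * e₀ ^ 4 + a₃ * g₀ * κ₁ * e₀ ^ 3 + b₃ * g₀ * κ₂ * e₀ ^ 5 + 6 * a₁ * b₁ * g₀ * g₁ * κ₃ * e₀ ^ 3 + 3 * b₁ ^ 2 * g₀ * g₁ * κ₄ * e₀ ^ 3 + 3 * g₀ * g₁ * g₂ * κ₃ * e₀ ^ 4 + 3 * a₂ * g₀ * g₁ * κ₂ * e₀ ^ 3 + 3 * b₂ * g₀ *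 g₁ * κ₃ * e₀ ^ 4 + g₁ ^ 3 * κ₃ * e₀ ^ 4 + 3 * a₁ * g₀ * g₁ ^ 2 * κ₃ * e₀ ^ 3 + 3 * b₁ * g₀ * g₁ ^ 2 * κ₄ * e₀ ^ 3 + g₀ * g₁ ^ 3 * κ₄ * e₀ ^ 3) * u ^ 3) := mul_le_mul_of_nonneg_left hS (by norm_num)
    _ = u ^ 2 * (3 * (u * (3 * a₁ * b₁ ^ 2 * g₀ * κ₃ * e₀ ^ 3 + b₁ ^ 3 * g₀ * κ₄ * e₀ ^ 3 + 3 * b₂' * g₀ * g₁ * κ₃ * e₀ ^ 4 + 3 * a₁ * g₀ * g₂ * κ₂ * e₀ ^ 4 + 3 * b₁ * g₀ * g₂ * κ₃ * e₀ ^ 4 + 3 * a₁ * b₂ * g₀ * κ₂ * e₀ ^ 4 + 3 * a₂ * b₁ * g₀ * κ₂ * e₀ ^ 3 + 3 * b₁ * b₂ * g₀ * κ₃ * e₀ ^ 4 + 3 * a₁ * g₁ ^ 2 * κ₂ * e₀ ^ 4 + 3 * b₁ * g₁ ^ 2 * κ₃ * e₀ ^ 4 + a₃ * g₀ * κ₁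 * e₀ ^ 3 + b₃ * g₀ * κ₂ * e₀ ^ 5 + 6 * a₁ * b₁ * g₀ * g₁ * κ₃ * e₀ ^ 3 + 3 * b₁ ^ 2 * g₀ * g₁ * κ₄ * e₀ ^ 3 + 3 * g₀ * g₁ * g₂ * κ₃ * e₀ ^ 4 + 3 * a₂ * g₀ * g₁ * κ₂ * e₀ ^ 3 + 3 * b₂ * g₀ * g₁ * κ₃ * e₀ ^ 4 + g₁ ^ 3 * κ₃ * e₀ ^ 4 + 3 * a₁ * g₀ * g₁ ^ 2 * κ₃ * e₀ ^ 3 + 3 * b₁ * g₀ * g₁ ^ 2 * κ₄ * e₀ ^ 3 + g₀ * g₁ ^ 3 * κ₄ * e₀ ^ 3))) := by ring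
    _ ≤ u ^ 2 * (1073741824 * κ₁ * g₃ * e₀ ^ 6) := mul_le_mul_of_nonneg_left hU (by positivity)
    _ = 1073741824 * κ₁ * g₃ * e₀ ^ 6 * u ^ 2 := by ring
    _ ≤ (κ₁ / Λ ^ 2) * (g₃ * u ^ 2) * x ^ 3 * (u ^ 3 * Λ ^ 8) := hT

/-- **Threshold `Y1` at the SHALLOW (c-D) depth** (twin of `cd_threshold_Y1`, with `G₀ = g₀u²` = the true size of the mean-free flow piece): `2·Y1 ≤ k₁G₂·x`
for every depth `x` with `1024e₀² ≤ x·u·Λ²` (ONE power of `u`) under the SAME `u`-smallness condition as at the deep base (multiplier `u^1Λ^4`). -/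
theorem cd_threshold_Y1_lin {{κ₁ κ₂ g₀ g₁ g₂ a₁ b₁ b₂' e₀ Λ u x k₁ k₂ G₀ G₁ G₂ α₁ : ℝ}}
    (hκ₁ : 0 ≤ κ₁) (hκ₂ : 0 ≤ κ₂) (hg₀ : 0 ≤ g₀) (hg₁ : 0 ≤ g₁) (hg₂ : 0 ≤ g₂) (ha₁ : 0 ≤ a₁) (hb₁ : 0 ≤ b₁) (hb₂' : 0 ≤ b₂')
    (hΛ : 0 < Λ) (hΛe : Λ ≤ e₀) (hu0 : 0 < u) (hu1 : u ≤ 1) (hx : 1024 * e₀ ^ 2 ≤ x * (u * Λ ^ 2))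
    (hk₁ : k₁ = κ₁ / Λ ^ 2) (hk₂ : k₂ = κ₂ / Λ ^ 3) (hG₀ : G₀ = g₀ * u ^ 2) (hG₁ : G₁ = g₁ * u ^ 2) (hG₂ : G₂ = g₂ * u ^ 2) (hα₁ : α₁ = a₁ / Λ)
    (hU : 2 * (u * (b₂' * g₀ * κ₂ * e₀ + 2 * a₁ * g₁ * κ₁ * e₀ + 2 * b₁ * g₁ * κ₂ * e₀)) ≤
      1024 * κ₁ * g₂ * e₀ ^ 2) :
    2 * (G₀ * k₂ * b₂' + 2 * G₁ * k₁ * α₁ + 2 * G₁ * k₂ * b₁) ≤ k₁ * G₂ * x := by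
  subst hk₁ hk₂ hG₀ hG₁ hG₂ hα₁
  have he : 0 < e₀ := lt_of_lt_of_le hΛ hΛe
  have t0 : (b₂' * g₀ * κ₂) * u ^ 3 * Λ ^ 1 ≤ (b₂' * g₀ * κ₂ * e₀) * u ^ 3 :=
    le_of_le_of_eq (mul_le_mul (mul_le_mul_of_nonneg_left (pow_le_pow_of_le_one hu0.le hu1 (show (3 : ℕ) ≤ 3 by norm_num)) (by positivity))
      (pow_le_pow_left₀ hΛ.le hΛe 1) (by positivity) (by positivity)) (by ring)
  have t1 : (2 * a₁ * g₁ * κ₁) * u ^ 3 * Λ ^ 1 ≤ (2 * a₁ * g₁ * κ₁ * e₀) * u ^ 3 :=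
    le_of_le_of_eq (mul_le_mul (mul_le_mul_of_nonneg_left (pow_le_pow_of_le_one hu0.le hu1 (show (3 : ℕ) ≤ 3 by norm_num)) (by positivity))
      (pow_le_pow_left₀ hΛ.le hΛe 1) (by positivity) (by positivity)) (by ring)
  have t2 : (2 * b₁ * g₁ * κ₂) * u ^ 3 * Λ ^ 1 ≤ (2 * b₁ * g₁ * κ₂ * e₀) * u ^ 3 :=
    le_of_le_of_eq (mul_le_mul (mul_le_mul_of_nonneg_left (pow_le_pow_of_le_one hu0.le hu1 (show (3 : ℕ) ≤ 3 by norm_num)) (by positivity))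
      (pow_le_pow_left₀ hΛ.le hΛe 1) (by positivity) (by positivity)) (by ring)
  have hS : ((g₀ * u ^ 2) * (κ₂ / Λ ^ 3) * b₂' + 2 * (g₁ * u ^ 2) * (κ₁ / Λ ^ 2) * (a₁ / Λ) + 2 * (g₁ * u ^ 2) * (κ₂ / Λ ^ 3) * b₁) * (u * Λ ^ 4) ≤
      (b₂' * g₀ * κ₂ * e₀ + 2 * a₁ * g₁ * κ₁ * e₀ + 2 * b₁ * g₁ * κ₂ * e₀) * u ^ 3 := by
    have e : ((g₀ * u ^ 2) * (κ₂ / Λ ^ 3) * b₂' + 2 * (g₁ * u ^ 2) * (κ₁ / Λ ^ 2) * (a₁ / Λ) + 2 * (g₁ * u ^ 2) * (κ₂ / Λ ^ 3) * b₁) * (u * Λ ^ 4) =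
        (b₂' * g₀ * κ₂) * u ^ 3 * Λ ^ 1 + (2 * a₁ * g₁ * κ₁) * u ^ 3 * Λ ^ 1 + (2 * b₁ * g₁ * κ₂) * u ^ 3 * Λ ^ 1 := by
      field_simp
    rw [e]
    linarith only [t0, t1, t2]
  have hT : 1024 * κ₁ * g₂ * e₀ ^ 2 * u ^ 2 ≤ (κ₁ / Λ ^ 2) * (g₂ * u ^ 2) * x * (u * Λ ^ 4) := by
    have hxi : (1024 * e₀ ^ 2) ^ 1 ≤ (x * (u * Λ ^ 2)) ^ 1 := pow_le_pow_left₀ (by positivity) hx 1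
    calc 1024 * κ₁ * g₂ * e₀ ^ 2 * u ^ 2 = κ₁ * g₂ * u ^ 2 * (1024 * e₀ ^ 2) ^ 1 := by ring
      _ ≤ κ₁ * g₂ * u ^ 2 * (x * (u * Λ ^ 2)) ^ 1 := mul_le_mul_of_nonneg_left hxi (by positivity)
      _ = (κ₁ / Λ ^ 2) * (g₂ * u ^ 2) * x * (u * Λ ^ 4) := by field_simp
  have hw : 0 < (u * Λ ^ 4) := by positivity
  refine le_of_mul_le_mul_right ?_ hw
  calc 2 * ((g₀ * u ^ 2) * (κ₂ / Λ ^ 3) * b₂' + 2 * (g₁ * u ^ 2) * (κ₁ / Λ ^ 2) * (a₁ / Λ) + 2 * (g₁ * u ^ 2) * (κ₂ / Λ ^ 3) * b₁) * (u * Λ ^ 4) = 2 * (((g₀ * u ^ 2) * (κ₂ / Λ ^ 3) * b₂' + 2 * (g₁ * u ^ 2) * (κ₁ / Λ ^ 2) * (a₁ / Λ) + 2 * (g₁ * u ^ 2) * (κ₂ / Λ ^ 3) * b₁) * (u * Λ ^ 4)) := by ring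
    _ ≤ 2 * ((b₂' * g₀ * κ₂ * e₀ + 2 * a₁ * g₁ * κ₁ * e₀ + 2 * b₁ * g₁ * κ₂ * e₀) * u ^ 3) := mul_le_mul_of_nonneg_left hS (by norm_num)
    _ = u ^ 2 * (2 * (u * (b₂' * g₀ * κ₂ * e₀ + 2 * a₁ * g₁ * κ₁ * e₀ + 2 * b₁ * g₁ * κ₂ * e₀))) := by ring
    _ ≤ u ^ 2 * (1024 * κ₁ * g₂ * e₀ ^ 2) := mul_le_mul_of_nonneg_left hU (by positivity)
    _ = 1024 * κ₁ * g₂ * e₀ ^ 2 * u ^ 2 := by ring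
    _ ≤ (κ₁ / Λ ^ 2) * (g₂ * u ^ 2) * x * (u * Λ ^ 4) := hT

/-- **Threshold `Y2` at the SHALLOW (c-D) depth** (twin of `cd_threshold_Y2`): `2·Y2 ≤ k₁G₂·x^2`
for every depth `x` with `1024e₀² ≤ x·u·Λ²` (ONE power of `u`) under the SAME `u`-smallness condition as at the deep base (multiplier `u^2Λ^6`). -/
theorem cd_threshold_Y2_lin {{κ₁ κ₂ κ₃ g₀ g₁ g₂ a₁ a₂ b₁ b₂ e₀ Λ u x k₁ k₂ k₃ G₀ G₁ G₂ α₁ α₂ : ℝ}}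
    (hκ₁ : 0 ≤ κ₁) (hκ₂ : 0 ≤ κ₂) (hκ₃ : 0 ≤ κ₃) (hg₀ : 0 ≤ g₀) (hg₁ : 0 ≤ g₁) (hg₂ : 0 ≤ g₂) (ha₁ : 0 ≤ a₁) (ha₂ : 0 ≤ a₂) (hb₁ : 0 ≤ b₁) (hb₂ : 0 ≤ b₂)
    (hΛ : 0 < Λ) (hΛe : Λ ≤ e₀) (hu0 : 0 < u) (hu1 : u ≤ 1) (hx : 1024 * e₀ ^ 2 ≤ x * (u * Λ ^ 2))
    (hk₁ : k₁ = κ₁ / Λ ^ 2) (hk₂ : k₂ = κ₂ / Λ ^ 3) (hk₃ : k₃ = κ₃ / Λ ^ 4) (hG₀ : G₀ = g₀ * u) (hG₁ : G₁ = g₁ * u ^ 2) (hG₂ : G₂ = g₂ * u ^ 2) (hα₁ : α₁ = a₁ / Λ) (hα₂ : α₂ = a₂ / Λ ^ 2)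
    (hU : 2 * (u * (2 * a₁ * b₁ * g₀ * κ₂ * e₀ ^ 2 + b₁ ^ 2 * g₀ * κ₃ * e₀ ^ 2 + g₀ * g₂ * κ₂ * e₀ ^ 3 + a₂ * g₀ * κ₁ * e₀ ^ 2 + b₂ * g₀ * κ₂ * e₀ ^ 3 + g₁ ^ 2 * κ₂ * e₀ ^ 3 + 2 * a₁ * g₀ * g₁ * κ₂ * e₀ ^ 2 + 2 * b₁ * g₀ * g₁ * κ₃ * e₀ ^ 2 + g₀ * g₁ ^ 2 * κ₃ * e₀ ^ 2)) ≤
      1048576 * κ₁ * g₂ * e₀ ^ 4) :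
    2 * ((2 * G₀ * k₂ * α₁ * b₁ + G₀ * k₃ * b₁ ^ 2 + G₀ * G₂ * k₂ + G₀ * k₁ * α₂ + G₀ * k₂ * b₂ + G₁ ^ 2 * k₂) + (2 * G₀ * G₁ * k₂ * α₁ + 2 * G₀ * G₁ * k₃ * b₁) + (G₀ * G₁ ^ 2 * k₃)) ≤ k₁ * G₂ * x ^ 2 := by
  subst hk₁ hk₂ hk₃ hG₀ hG₁ hG₂ hα₁ hα₂
  have he : 0 < e₀ := lt_of_lt_of_le hΛ hΛe
  have t0 : (2 * a₁ * b₁ * g₀ * κ₂) * u ^ 3 * Λ ^ 2 ≤ (2 * a₁ * b₁ * g₀ * κ₂ * e₀ ^ 2) * u ^ 3 :=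
    le_of_le_of_eq (mul_le_mul (mul_le_mul_of_nonneg_left (pow_le_pow_of_le_one hu0.le hu1 (show (3 : ℕ) ≤ 3 by norm_num)) (by positivity))
      (pow_le_pow_left₀ hΛ.le hΛe 2) (by positivity) (by positivity)) (by ring)
  have t1 : (b₁ ^ 2 * g₀ * κ₃) * u ^ 3 * Λ ^ 2 ≤ (b₁ ^ 2 * g₀ * κ₃ * e₀ ^ 2) * u ^ 3 :=
    le_of_le_of_eq (mul_le_mul (mul_le_mul_of_nonneg_left (pow_le_pow_of_le_one hu0.le hu1 (show (3 : ℕ) ≤ 3 by norm_num)) (by positivity))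
      (pow_le_pow_left₀ hΛ.le hΛe 2) (by positivity) (by positivity)) (by ring)
  have t2 : (g₀ * g₂ * κ₂) * u ^ 5 * Λ ^ 3 ≤ (g₀ * g₂ * κ₂ * e₀ ^ 3) * u ^ 3 :=
    le_of_le_of_eq (mul_le_mul (mul_le_mul_of_nonneg_left (pow_le_pow_of_le_one hu0.le hu1 (show (3 : ℕ) ≤ 5 by norm_num)) (by positivity))
      (pow_le_pow_left₀ hΛ.le hΛe 3) (by positivity) (by positivity)) (by ring)
  have t3 : (a₂ * g₀ * κ₁) * u ^ 3 * Λ ^ 2 ≤ (a₂ * g₀ * κ₁ * e₀ ^ 2) * u ^ 3 :=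
    le_of_le_of_eq (mul_le_mul (mul_le_mul_of_nonneg_left (pow_le_pow_of_le_one hu0.le hu1 (show (3 : ℕ) ≤ 3 by norm_num)) (by positivity))
      (pow_le_pow_left₀ hΛ.le hΛe 2) (by positivity) (by positivity)) (by ring)
  have t4 : (b₂ * g₀ * κ₂) * u ^ 3 * Λ ^ 3 ≤ (b₂ * g₀ * κ₂ * e₀ ^ 3) * u ^ 3 :=
    le_of_le_of_eq (mul_le_mul (mul_le_mul_of_nonneg_left (pow_le_pow_of_le_one hu0.le hu1 (show (3 : ℕ) ≤ 3 by norm_num)) (by positivity))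
      (pow_le_pow_left₀ hΛ.le hΛe 3) (by positivity) (by positivity)) (by ring)
  have t5 : (g₁ ^ 2 * κ₂) * u ^ 6 * Λ ^ 3 ≤ (g₁ ^ 2 * κ₂ * e₀ ^ 3) * u ^ 3 :=
    le_of_le_of_eq (mul_le_mul (mul_le_mul_of_nonneg_left (pow_le_pow_of_le_one hu0.le hu1 (show (3 : ℕ) ≤ 6 by norm_num)) (by positivity))
      (pow_le_pow_left₀ hΛ.le hΛe 3) (by positivity) (by positivity)) (by ring)
  have t6 : (2 * a₁ * g₀ * g₁ * κ₂) * u ^ 5 * Λ ^ 2 ≤ (2 * a₁ * g₀ * g₁ * κ₂ * e₀ ^ 2) * u ^ 3 :=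
    le_of_le_of_eq (mul_le_mul (mul_le_mul_of_nonneg_left (pow_le_pow_of_le_one hu0.le hu1 (show (3 : ℕ) ≤ 5 by norm_num)) (by positivity))
      (pow_le_pow_left₀ hΛ.le hΛe 2) (by positivity) (by positivity)) (by ring)
  have t7 : (2 * b₁ * g₀ * g₁ * κ₃) * u ^ 5 * Λ ^ 2 ≤ (2 * b₁ * g₀ * g₁ * κ₃ * e₀ ^ 2) * u ^ 3 :=
    le_of_le_of_eq (mul_le_mul (mul_le_mul_of_nonneg_left (pow_le_pow_of_le_one hu0.le hu1 (show (3 : ℕ) ≤ 5 by norm_num)) (by positivity))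
      (pow_le_pow_left₀ hΛ.le hΛe 2) (by positivity) (by positivity)) (by ring)
  have t8 : (g₀ * g₁ ^ 2 * κ₃) * u ^ 7 * Λ ^ 2 ≤ (g₀ * g₁ ^ 2 * κ₃ * e₀ ^ 2) * u ^ 3 :=
    le_of_le_of_eq (mul_le_mul (mul_le_mul_of_nonneg_left (pow_le_pow_of_le_one hu0.le hu1 (show (3 : ℕ) ≤ 7 by norm_num)) (by positivity))
      (pow_le_pow_left₀ hΛ.le hΛe 2) (by positivity) (by positivity)) (by ring)
  have hS : ((2 * (g₀ * u) * (κ₂ / Λ ^ 3) * (a₁ / Λ) * b₁ + (g₀ * u) * (κ₃ / Λ ^ 4) * b₁ ^ 2 + (g₀ * u) * (g₂ * u ^ 2) * (κ₂ / Λ ^ 3) + (g₀ * u) * (κ₁ / Λ ^ 2) * (a₂ / Λ ^ 2) + (g₀ * u) * (κ₂ / Λ ^ 3) * b₂ + (g₁ * u ^ 2) ^ 2 * (κ₂ / Λ ^ 3)) + (2 * (g₀ * u) * (g₁ * u ^ 2) * (κ₂ / Λ ^ 3) * (a₁ / Λ) + 2 * (g₀ * u) * (g₁ * u ^ 2) *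 (κ₃ / Λ ^ 4) * b₁) + ((g₀ * u) * (g₁ * u ^ 2) ^ 2 * (κ₃ / Λ ^ 4))) * (u ^ 2 * Λ ^ 6) ≤
      (2 * a₁ * b₁ * g₀ * κ₂ * e₀ ^ 2 + b₁ ^ 2 * g₀ * κ₃ * e₀ ^ 2 + g₀ * g₂ * κ₂ * e₀ ^ 3 + a₂ * g₀ * κ₁ * e₀ ^ 2 + b₂ * g₀ * κ₂ * e₀ ^ 3 + g₁ ^ 2 * κ₂ * e₀ ^ 3 + 2 * a₁ * g₀ * g₁ * κ₂ * e₀ ^ 2 + 2 * b₁ * g₀ * g₁ * κ₃ * e₀ ^ 2 + g₀ * g₁ ^ 2 * κ₃ * e₀ ^ 2) * u ^ 3 := by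
    have e : ((2 * (g₀ * u) * (κ₂ / Λ ^ 3) * (a₁ / Λ) * b₁ + (g₀ * u) * (κ₃ / Λ ^ 4) * b₁ ^ 2 + (g₀ * u) * (g₂ * u ^ 2) * (κ₂ / Λ ^ 3) + (g₀ * u) * (κ₁ / Λ ^ 2) * (a₂ / Λ ^ 2) + (g₀ * u) * (κ₂ / Λ ^ 3) * b₂ + (g₁ * u ^ 2) ^ 2 * (κ₂ / Λ ^ 3)) + (2 * (g₀ * u) * (g₁ * u ^ 2) * (κ₂ / Λ ^ 3) * (a₁ / Λ) + 2 * (g₀ * u) * (g₁ * u ^ 2) * (κ₃ / Λ ^ 4) * b₁) + ((g₀ * u) * (g₁ * u ^ 2) ^ 2 * (κ₃ / Λ ^ 4))) * (u ^ 2 * Λ ^ 6) =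
        (2 * a₁ * b₁ * g₀ * κ₂) * u ^ 3 * Λ ^ 2 + (b₁ ^ 2 * g₀ * κ₃) * u ^ 3 * Λ ^ 2 + (g₀ * g₂ * κ₂) * u ^ 5 * Λ ^ 3 + (a₂ * g₀ * κ₁) * u ^ 3 * Λ ^ 2 + (b₂ * g₀ * κ₂) * u ^ 3 * Λ ^ 3 + (g₁ ^ 2 * κ₂) * u ^ 6 * Λ ^ 3 + (2 * a₁ * g₀ * g₁ * κ₂) * u ^ 5 * Λ ^ 2 + (2 * b₁ * g₀ * g₁ * κ₃) * u ^ 5 * Λ ^ 2 + (g₀ * g₁ ^ 2 * κ₃) * u ^ 7 * Λ ^ 2 := by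
      field_simp
      ring
    rw [e]
    linarith only [t0, t1, t2, t3, t4, t5, t6, t7, t8]
  have hT : 1048576 * κ₁ * g₂ * e₀ ^ 4 * u ^ 2 ≤ (κ₁ / Λ ^ 2) * (g₂ * u ^ 2) * x ^ 2 * (u ^ 2 * Λ ^ 6) := by
    have hxi : (1024 * e₀ ^ 2) ^ 2 ≤ (x * (u * Λ ^ 2)) ^ 2 := pow_le_pow_left₀ (by positivity) hx 2
    calc 1048576 * κ₁ * g₂ * e₀ ^ 4 * u ^ 2 = κ₁ * g₂ * u ^ 2 * (1024 * e₀ ^ 2) ^ 2 := by ring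
      _ ≤ κ₁ * g₂ * u ^ 2 * (x * (u * Λ ^ 2)) ^ 2 := mul_le_mul_of_nonneg_left hxi (by positivity)
      _ = (κ₁ / Λ ^ 2) * (g₂ * u ^ 2) * x ^ 2 * (u ^ 2 * Λ ^ 6) := by field_simp
  have hw : 0 < (u ^ 2 * Λ ^ 6) := by positivity
  refine le_of_mul_le_mul_right ?_ hw
  calc 2 * ((2 * (g₀ * u) * (κ₂ / Λ ^ 3) * (a₁ / Λ) * b₁ + (g₀ * u) * (κ₃ / Λ ^ 4) * b₁ ^ 2 + (g₀ * u) * (g₂ * u ^ 2) * (κ₂ / Λ ^ 3) + (g₀ * u) * (κ₁ / Λ ^ 2) * (a₂ / Λ ^ 2) + (g₀ * u) * (κ₂ / Λ ^ 3) * b₂ + (g₁ * u ^ 2) ^ 2 * (κ₂ / Λ ^ 3)) + (2 * (g₀ * u) * (g₁ * u ^ 2) * (κ₂ / Λ ^ 3) * (a₁ / Λ) + 2 * (g₀ * u) * (g₁ * u ^ 2) * (κ₃ / Λ ^ 4) * b₁) + ((g₀ * u) * (g₁ * u ^ 2) ^ 2 * (κ₃ / Λ ^ 4))) * (u ^ 2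 * Λ ^ 6) = 2 * (((2 * (g₀ * u) * (κ₂ / Λ ^ 3) * (a₁ / Λ) * b₁ + (g₀ * u) * (κ₃ / Λ ^ 4) * b₁ ^ 2 + (g₀ * u) * (g₂ * u ^ 2) * (κ₂ / Λ ^ 3) + (g₀ * u) * (κ₁ / Λ ^ 2) * (a₂ / Λ ^ 2) + (g₀ * u) * (κ₂ / Λ ^ 3) * b₂ + (g₁ * u ^ 2) ^ 2 * (κ₂ / Λ ^ 3)) + (2 * (g₀ * u) * (g₁ * u ^ 2) * (κ₂ / Λ ^ 3) * (a₁ / Λ) + 2 * (g₀ * u) * (g₁ * u ^ 2) * (κ₃ / Λ ^ 4) * b₁) + ((g₀ * u) * (g₁ * u ^ 2) ^ 2 * (κ₃ / Λ ^ 4))) * (u ^ 2 * Λ ^ 6)) := by ring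
    _ ≤ 2 * ((2 * a₁ * b₁ * g₀ * κ₂ * e₀ ^ 2 + b₁ ^ 2 * g₀ * κ₃ * e₀ ^ 2 + g₀ * g₂ * κ₂ * e₀ ^ 3 + a₂ * g₀ * κ₁ * e₀ ^ 2 + b₂ * g₀ * κ₂ * e₀ ^ 3 + g₁ ^ 2 * κ₂ * e₀ ^ 3 + 2 * a₁ * g₀ * g₁ * κ₂ * e₀ ^ 2 + 2 * b₁ * g₀ * g₁ * κ₃ * e₀ ^ 2 + g₀ * g₁ ^ 2 * κ₃ * e₀ ^ 2) * u ^ 3) := mul_le_mul_of_nonneg_left hS (by norm_num)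
    _ = u ^ 2 * (2 * (u * (2 * a₁ * b₁ * g₀ * κ₂ * e₀ ^ 2 + b₁ ^ 2 * g₀ * κ₃ * e₀ ^ 2 + g₀ * g₂ * κ₂ * e₀ ^ 3 + a₂ * g₀ * κ₁ * e₀ ^ 2 + b₂ * g₀ * κ₂ * e₀ ^ 3 + g₁ ^ 2 * κ₂ * e₀ ^ 3 + 2 * a₁ * g₀ * g₁ * κ₂ * e₀ ^ 2 + 2 * b₁ * g₀ * g₁ * κ₃ * e₀ ^ 2 + g₀ * g₁ ^ 2 * κ₃ * e₀ ^ 2))) := by ring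
    _ ≤ u ^ 2 * (1048576 * κ₁ * g₂ * e₀ ^ 4) := mul_le_mul_of_nonneg_left hU (by positivity)
    _ = 1048576 * κ₁ * g₂ * e₀ ^ 4 * u ^ 2 := by ring
    _ ≤ (κ₁ / Λ ^ 2) * (g₂ * u ^ 2) * x ^ 2 * (u ^ 2 * Λ ^ 6) := hT

/-- **The SHALLOW (c-D) depth in closed form**: `m ≥ 2j + 5 + ⌈log₄ |U|⁻¹⌉₊` gives `1024·e₀² ≤ 4^m·(|U|·Λ_j²)`, `Λ_j = e₀·4^{−j}` (`0 < |U| ≤ 1`, `0 < e₀`) — the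
depth hypothesis of `cd_threshold_*_lin` (twin of `cd_depth_lower`, one logarithm of `|U|` instead of two). -/
theorem cd_depth_lower_lin {e₀ U : ℝ} (he : 0 < e₀) (hU : 0 < |U|) {j m : ℕ} (hm : 2 * j + 5 + ⌈Real.logb 4 |U|⁻¹⌉₊ ≤ m) :
    1024 * e₀ ^ 2 ≤ (4 : ℝ) ^ m * (|U| * (e₀ * ((4 : ℝ) ^ j)⁻¹) ^ 2) := by
  -- `4^{⌈log₄ |U|⁻¹⌉₊} ≥ |U|⁻¹`
  have hceil : |U|⁻¹ ≤ (4 : ℝ) ^ ⌈Real.logb 4 |U|⁻¹⌉₊ := by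
    have hinv : 0 < |U|⁻¹ := inv_pos.2 hU
    have h1 : Real.logb 4 |U|⁻¹ ≤ (⌈Real.logb 4 |U|⁻¹⌉₊ : ℝ) := Nat.le_ceil _
    have h3 : (4 : ℝ) ^ (Real.logb 4 |U|⁻¹) ≤ (4 : ℝ) ^ ((⌈Real.logb 4 |U|⁻¹⌉₊ : ℕ) : ℝ) :=
      Real.rpow_le_rpow_of_exponent_le (show (1 : ℝ) ≤ 4 by norm_num) h1
    rwa [Real.rpow_logb (by norm_num) (by norm_num) hinv, Real.rpow_natCast] at h3
  have h4m : (4 : ℝ) ^ (2 * j + 5 + ⌈Real.logb 4 |U|⁻¹⌉₊) ≤ (4 : ℝ) ^ m := pow_le_pow_right₀ (by norm_num) hm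
  rw [pow_add, pow_add] at h4m
  have h4j : 0 < (4 : ℝ) ^ j := by positivity
  have hU0 : |U| ≠ 0 := hU.ne'
  -- `1024 e₀² = 4^{2j}·4⁵·|U|⁻¹·(|U|·Λ_j²)`
  have key : 1024 * e₀ ^ 2 = (4 : ℝ) ^ (2 * j) * (4 : ℝ) ^ 5 * |U|⁻¹ * (|U| * (e₀ * ((4 : ℝ) ^ j)⁻¹) ^ 2) := by
    rw [pow_mul']; field_simp; ring
  rw [key]
  have hW : 0 ≤ |U| * (e₀ * ((4 : ℝ) ^ j)⁻¹) ^ 2 := by positivity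
  calc (4 : ℝ) ^ (2 * j) * (4 : ℝ) ^ 5 * |U|⁻¹ * (|U| * (e₀ * ((4 : ℝ) ^ j)⁻¹) ^ 2)
      ≤ (4 : ℝ) ^ (2 * j) * (4 : ℝ) ^ 5 * (4 : ℝ) ^ ⌈Real.logb 4 |U|⁻¹⌉₊ * (|U| * (e₀ * ((4 : ℝ) ^ j)⁻¹) ^ 2) :=
        mul_le_mul_of_nonneg_right (mul_le_mul_of_nonneg_left hceil (by positivity)) hW
    _ ≤ (4 : ℝ) ^ m * (|U| * (e₀ * ((4 : ℝ) ^ j)⁻¹) ^ 2) := mul_le_mul_of_nonneg_right h4m hW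

/-- **The same depth in the window currency of the derivative route** (`…AlphaWtFlowDeep`, `…SectorMultiplierOverlapWtFlowDeep`): `1024·e₀² ≤ 4^m·(|U|·Λ_j²)` with
`Λ_j = e₀·4^{−j}` says `1024·16^j ≤ 4^m·|U|`, i.e. the telescope's first piece sits where `4^m·|U| ≍ 4^{2j}` — the edge of the window `4^{m+2}·U ≤ 4^{2·nf+d}` of the
plain route up to the `O(1)` offset (`e₀ > 0` cancels). -/
theorem pow_window_of_cd_depth_lin {e₀ U : ℝ} (he : 0 < e₀) {j m : ℕ} (h : 1024 * e₀ ^ 2 ≤ (4 : ℝ) ^ m * (|U| * (e₀ * ((4 : ℝ) ^ j)⁻¹) ^ 2)) :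
    1024 * ((4 : ℝ) ^ j) ^ 2 ≤ (4 : ℝ) ^ m * |U| := by
  have h4j : 0 < (4 : ℝ) ^ j := by positivity
  have e : (4 : ℝ) ^ m * (|U| * (e₀ * ((4 : ℝ) ^ j)⁻¹) ^ 2) = ((4 : ℝ) ^ m * |U|) * e₀ ^ 2 / ((4 : ℝ) ^ j) ^ 2 := by
    field_simp
  rw [e, le_div_iff₀ (by positivity)] at h
  have he2 : 0 < e₀ ^ 2 := by positivity
  nlinarith [h, he2]

/-- **The ceiling logarithm costs at most one factor `4`**: for `0 < u ≤ 1`, `4^{⌈log₄ u⁻¹⌉₊}·u ≤ 4`. [folklore] -/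
theorem pow_ceil_logb_mul_le {u : ℝ} (hu0 : 0 < u) (hu1 : u ≤ 1) : (4 : ℝ) ^ ⌈Real.logb 4 u⁻¹⌉₊ * u ≤ 4 := by
  have hinv : 0 < u⁻¹ := inv_pos.2 hu0
  have hx0 : 0 ≤ Real.logb 4 u⁻¹ := Real.logb_nonneg (by norm_num) ((one_le_inv₀ hu0).2 hu1)
  have h1 : ((⌈Real.logb 4 u⁻¹⌉₊ : ℕ) : ℝ) ≤ Real.logb 4 u⁻¹ + 1 := (Nat.ceil_lt_add_one hx0).le
  have h2 : (4 : ℝ) ^ ⌈Real.logb 4 u⁻¹⌉₊ ≤ (4 : ℝ) ^ (Real.logb 4 u⁻¹ + 1) := by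
    rw [← Real.rpow_natCast]
    exact Real.rpow_le_rpow_of_exponent_le (by norm_num) h1
  have h3 : (4 : ℝ) ^ (Real.logb 4 u⁻¹ + 1) = u⁻¹ * 4 := by
    rw [Real.rpow_add_one (by norm_num), Real.rpow_logb (by norm_num) (by norm_num) hinv]
  calc (4 : ℝ) ^ ⌈Real.logb 4 u⁻¹⌉₊ * u ≤ (4 : ℝ) ^ (Real.logb 4 u⁻¹ + 1) * u := mul_le_mul_of_nonneg_right h2 hu0.le
    _ = 4 := by rw [h3]; field_simp

/-- **From the (c-D) base depth of record to the window of the derivative route**: if `m ≤ c + ⌈log₄ |U|⁻¹⌉₊` (`0 < |U| ≤ 1`) then `4^m·|U| ≤ 4^{c+1}` — so a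
telescope base `m₀ = 2j + 5 + ⌈log₄|U|⁻¹⌉₊` (pen (R68e)) satisfies the window hypothesis `4^{m₀+2}·U ≤ 4^{2·nf+d}` of `…AlphaWtFlowDeep` /
`…SectorMultiplierOverlapWtFlowDeep` with `d` absolute (`2·nf + d ≥ 2j + 8`, `0 < U`). [folklore] -/
theorem pow_mul_le_of_le_add_ceil_logb {U : ℝ} (hU : 0 < |U|) (hU1 : |U| ≤ 1) {m c : ℕ} (hm : m ≤ c + ⌈Real.logb 4 |U|⁻¹⌉₊) :
    (4 : ℝ) ^ m * |U| ≤ (4 : ℝ) ^ (c + 1) := by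
  have h1 : (4 : ℝ) ^ m ≤ (4 : ℝ) ^ (c + ⌈Real.logb 4 |U|⁻¹⌉₊) := pow_le_pow_right₀ (by norm_num) hm
  calc (4 : ℝ) ^ m * |U| ≤ (4 : ℝ) ^ (c + ⌈Real.logb 4 |U|⁻¹⌉₊) * |U| := mul_le_mul_of_nonneg_right h1 hU.le
    _ = (4 : ℝ) ^ c * ((4 : ℝ) ^ ⌈Real.logb 4 |U|⁻¹⌉₊ * |U|) := by rw [pow_add]; ring
    _ ≤ (4 : ℝ) ^ c * 4 := mul_le_mul_of_nonneg_left (pow_ceil_logb_mul_le hU hU1) (by positivity)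
    _ = (4 : ℝ) ^ (c + 1) := by rw [pow_succ]

end Summit.HubbardSuperconductivity.HubbardSuperconductivity.Theorems.EngineV8

end
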